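import Literature.NumberTheory.EllipticCurves.AnticyclotomicInertiaAboveP
import Literature.NumberTheory.EllipticCurves.InertiaAboveEllCyclotomicProofs
import Literature.NumberTheory.EllipticCurves.BigGaloisRepSelmer
import Literature.NumberTheory.EllipticCurves.HeegnerPoints
import Literature.NumberTheory.Automorphic.AdicCompletionLocalField
import HarnessLib

/-!
# Inertia elements above a SPLIT prime with PRESCRIBED cyclotomic character, and the torsion ones lie in `G_{K̃_∞}`
# (the element `σ₀` of the corner stub (FIX) of crux 25505; proofs only)

Topic `NumberTheory/EllipticCurves` (namespace `Literature.NumberTheory.EllipticCurves.ZpExtension`). THEOREMS ONLY (no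
definition, no named fact; D-0026). For a quadratic field `K` in which the odd prime `p` SPLITS (`v ≠ v̄` above `p`):

* `exists_mem_inertia_cyclotomicCharacter_eq_of_split` — **`χ_p(I_𝔓) = ℤ_pˣ` for every prime `𝔓` of `\bar ℤ_K` above `p`**:
  the tree's `χ_p(I_{𝔓 ∩ \bar ℤ}) = ℤ_pˣ` over `ℚ` (`exists_mem_inertia_cyclotomicCharacter_eq`, Neukirch II (7.13)) lands in
  `res(Γ_K)` because the whole decomposition group of a completely split prime does
  (`SorensenPatching.decompositionSubgroup_le_range_of_ncard_primesOver_eq`), and `χ_p^K = χ_p^ℚ ∘ res`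
  (`cyclotomicCharacter_eq_cyclotomicCharacter_rat_absGaloisRestrict`). (The tree's `exists_mem_inertia_cyclotomicCharacter_ne_one`
  gives only `≠ 1` for a general number field.)
* `exists_mem_inertia_torsion_of_split` — **for a TORSION `u ∈ ℤ_pˣ` the inertia element `τ` with `χ_p(τ) = u` lies in `ker κ'` for the
  cyclotomic `κ'` (`ker κ' = χ_p⁻¹(torsion)`) AND in `ker κ` for every other `ℤ_p`-extension `κ`** (the two `ℤ_p`-characters are
  proportional on `I_𝔓` at a split prime, `toAdd_mul_comm_of_mem_inertia_of_ncard_primesOver_eq`, and `κ'` is ramified there: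
  an inertia element with NON-torsion cyclotomic character, `exists_unit_pow_ne_one`).
* `exists_localGroup_inertia_torsion_of_split` — the same as an element of the local Galois group `Γ_{K_v̄}`
  (`BigGaloisRep.LocalGroup K (Sum.inl v̄)`, inertia `absInertia`, via `inertia_adicCompletionPrime_eq_map_absInertia`).

Use (cell `bsd-stepL`, crux 25505, v6 stub (FIX), memo `LOCALDEFECT-25505-imc-p1-g23.md` §1bis step (3)): with `u = ζ` of order `p − 1`
the element `σ₀ ∈ P = ker κ| ∩ ker κ'|` acts on the ordinary line by `ζ^{k−1} ≠ 1` (`k` even), the input `h₀` of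
`Summits/…/Theorems/ErratumRoadFiveFixedPartTriangularReduction.lean`.

References: [NeukirchANT1999] II (7.13), I (9.4); [SerreLocalFields1979] IV §4 Prop. 17; [Washington1997] §13.1; [Brink2007] §II.
-/

noncomputable section

open Field NumberField IsDedekindDomain
open Literature.NumberTheory.GaloisRepresentations Literature.NumberTheory.EllipticCurves

namespace Literature.NumberTheory.EllipticCurves.ZpExtension

variable {K : Type} [Field K] [NumberField K] {p : ℕ} [Fact p.Prime]

/-- **`χ_p(I_𝔓) = ℤ_pˣ` above a split prime of a quadratic field**: for `[K : ℚ] = 2`, `v ≠ v̄` above `p`, `𝔓` a prime of `\bar ℤ_K`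
above `v̄` and `u ∈ ℤ_pˣ`, some `τ ∈ I_𝔓 ≤ Γ_K` has `χ_p(τ) = u`. [cite: NeukirchANT1999, Ch. II (7.13) and Ch. I (9.4)] -/
theorem exists_mem_inertia_cyclotomicCharacter_eq_of_split (hK2 : Module.finrank ℚ K = 2)
    {v vbar : HeightOneSpectrum (𝓞 K)} (hpv : ((p : ℕ) : 𝓞 K) ∈ v.asIdeal)
    (hpvbar : ((p : ℕ) : 𝓞 K) ∈ vbar.asIdeal) (hne : vbar ≠ v)
    {𝔓 : Ideal (absIntegers (𝓞 K) K)} (h𝔓 : 𝔓 ∈ vbar.primesAbove) (u : ℤ_[p]ˣ) :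
    ∃ τ ∈ 𝔓.inertia (absoluteGaloisGroup K), GaloisRep.cyclotomicCharacter K p τ = u := by
  have hp : p.Prime := Fact.out
  haveI : Algebra.IsQuadraticExtension ℚ K := ⟨hK2⟩
  haveI : IsGalois ℚ K := inferInstance
  -- the place `u₀ = (p)` of `ℚ` below `v̄`
  obtain ⟨u₀, hwu, hu₀⟩ := exists_heightOneSpectrum_rat_under hp hpvbar
  have hu₀eq : u₀ = vbar.under (𝓞 ℚ) :=
    HeightOneSpectrum.ext (by rw [← hwu, HeightOneSpectrum.under_asIdeal])
  have hsplit : (u₀.asIdeal.primesOver (𝓞 K)).ncard = Module.finrank ℚ K := by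
    rw [hu₀eq]
    exact ncard_primesOver_under_eq_finrank_of_ne hK2 hpvbar hpv hne.symm
  -- the prime of `\bar ℤ_ℚ` below `𝔓`, and an inertia element there with `χ = u`
  have h𝔔 : 𝔓.comap (absIntegersMap ℚ K) ∈ u₀.primesAbove := comap_absIntegersMap_mem_primesAbove hwu h𝔓
  obtain ⟨τ', hτ'I, hτ'χ⟩ := exists_mem_inertia_cyclotomicCharacter_eq p hu₀ h𝔔 u
  -- it is a restriction from `Γ_K` (split prime)
  have hτ'D := Ideal.inertia_le_decompositionSubgroup (absoluteGaloisGroup ℚ) _ hτ'I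
  obtain ⟨τ, hτ⟩ := SorensenPatching.decompositionSubgroup_le_range_of_ncard_primesOver_eq hsplit h𝔔 hτ'D
  have hτ : absGaloisRestrict ℚ K τ = τ' := hτ
  refine ⟨τ, ?_, ?_⟩
  · rw [← comap_inertia_comap_absIntegersMap ℚ K 𝔓, Subgroup.mem_comap]
    change absGaloisRestrict ℚ K τ ∈ _
    rw [hτ]
    exact hτ'I
  · rw [cyclotomicCharacter_eq_cyclotomicCharacter_rat_absGaloisRestrict K p τ, hτ, hτ'χ]

/-- **A torsion inertia element lies in `ker κ' ∩ ker κ`**: `K` quadratic, `p ≠ 2` split (`v ≠ v̄`), `𝔓 ∣ v̄`, `κ'` CYCLOTOMIC and `κ`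
ANY `ℤ_p`-extension; for a torsion `u ∈ ℤ_pˣ` there is `τ ∈ I_𝔓` with `χ_p(τ) = u`, `κ'(τ) = 0` and `κ(τ) = 0` — `ker κ' = χ_p⁻¹(torsion)`,
and the proportionality `κ(τ)·κ'(τ₁) = κ'(τ)·κ(τ₁) = 0` with a ramified `τ₁ ∈ I_𝔓` for `κ'` (non-torsion cyclotomic value).
[cite: Washington1997, §13.1] [cite: SerreLocalFields1979, Ch. XIV §7 Thm. 2] -/
theorem exists_mem_inertia_torsion_of_split (hK2 : Module.finrank ℚ K = 2) (hp2 : p ≠ 2)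
    {v vbar : HeightOneSpectrum (𝓞 K)} (hpv : ((p : ℕ) : 𝓞 K) ∈ v.asIdeal)
    (hpvbar : ((p : ℕ) : 𝓞 K) ∈ vbar.asIdeal) (hne : vbar ≠ v)
    {𝔓 : Ideal (absIntegers (𝓞 K) K)} (h𝔓 : 𝔓 ∈ vbar.primesAbove)
    (κ κ' : ZpExtension K p) (hκ' : κ'.IsCyclotomic) (u : ℤ_[p]ˣ) (hu : u ∈ CommGroup.torsion ℤ_[p]ˣ) :
    ∃ τ ∈ 𝔓.inertia (absoluteGaloisGroup K), GaloisRep.cyclotomicCharacter K p τ = u ∧ κ' τ = 1 ∧ κ τ = 1 := by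
  have hp : p.Prime := Fact.out
  haveI : Algebra.IsQuadraticExtension ℚ K := ⟨hK2⟩
  haveI : IsGalois ℚ K := inferInstance
  obtain ⟨τ, hτI, hτχ⟩ := exists_mem_inertia_cyclotomicCharacter_eq_of_split hK2 hpv hpvbar hne h𝔓 u
  -- `κ'(τ) = 0`: `χ_p(τ)` is torsion
  have hκ'τ : κ' τ = 1 := by
    rw [← mem_kerSubgroup, hκ']
    exact Subgroup.mem_comap.mpr (by change GaloisRep.cyclotomicCharacter K p τ ∈ _; rw [hτχ]; exact hu)
  refine ⟨τ, hτI, hτχ, hκ'τ, ?_⟩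
  -- a ramified element `τ₁ ∈ I_𝔓` for `κ'`: non-torsion cyclotomic value
  obtain ⟨w, hw⟩ := exists_unit_pow_ne_one p
  obtain ⟨τ₁, hτ₁I, hτ₁χ⟩ := exists_mem_inertia_cyclotomicCharacter_eq_of_split hK2 hpv hpvbar hne h𝔓 w
  have hκ'τ₁ : κ' τ₁ ≠ 1 := by
    rw [Ne, ← mem_kerSubgroup, hκ']
    intro hmem
    have hw' : w ∈ CommGroup.torsion ℤ_[p]ˣ := by
      have h := Subgroup.mem_comap.mp hmem
      change GaloisRep.cyclotomicCharacter K p τ₁ ∈ _ at h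
      rwa [hτ₁χ] at h
    obtain ⟨n, hn, hwn⟩ := (isOfFinOrder_iff_pow_eq_one).mp ((CommGroup.mem_torsion w).mp hw')
    exact hw n hn hwn
  -- proportionality on `I_𝔓` at the split prime
  obtain ⟨u₀, hwu, hu₀⟩ := exists_heightOneSpectrum_rat_under hp hpvbar
  have hu₀eq : u₀ = vbar.under (𝓞 ℚ) :=
    HeightOneSpectrum.ext (by rw [← hwu, HeightOneSpectrum.under_asIdeal])
  have hsplit : (u₀.asIdeal.primesOver (𝓞 K)).ncard = Module.finrank ℚ K := by
    rw [hu₀eq]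
    exact ncard_primesOver_under_eq_finrank_of_ne hK2 hpvbar hpv hne.symm
  have hdet := toAdd_mul_comm_of_mem_inertia_of_ncard_primesOver_eq hp2 hu₀ hsplit hwu h𝔓
    κ.toContinuousMonoidHom.toMonoidHom κ'.toContinuousMonoidHom.toMonoidHom
    κ.toContinuousMonoidHom.continuous κ'.toContinuousMonoidHom.continuous hτI hτ₁I
  change (κ τ).toAdd * (κ' τ₁).toAdd = (κ' τ).toAdd * (κ τ₁).toAdd at hdet
  rw [hκ'τ, toAdd_one, zero_mul, mul_eq_zero] at hdet
  rcases hdet with h | h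
  · exact Multiplicative.toAdd.injective (by rw [h, toAdd_one])
  · exact absurd (Multiplicative.toAdd.injective (by rw [h, toAdd_one])) hκ'τ₁

/-- **The same as an element of the local Galois group `Γ_{K_v̄}`**: there is `σ₀` in the inertia group `absInertia (K_v̄)` of the local
absolute Galois group `BigGaloisRep.LocalGroup K (Sum.inl v̄)` whose image in `Γ_K` (`localMap`) has `χ_p = u`, `κ' = 0`, `κ = 0`
(`I_{𝔓₀} = res(I_{K_v̄})` for the prime `𝔓₀` cut out by `K̄ → K̄_v̄`, `inertia_adicCompletionPrime_eq_map_absInertia`). The `σ₀ ∈ P`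
of the (FIX) triangular reduction. [cite: NeukirchANT1999, Ch. II §9 Prop. (9.6) and (7.13)] -/
theorem exists_localGroup_inertia_torsion_of_split (hK2 : Module.finrank ℚ K = 2) (hp2 : p ≠ 2)
    {v vbar : HeightOneSpectrum (𝓞 K)} (hpv : ((p : ℕ) : 𝓞 K) ∈ v.asIdeal)
    (hpvbar : ((p : ℕ) : 𝓞 K) ∈ vbar.asIdeal) (hne : vbar ≠ v)
    (κ κ' : ZpExtension K p) (hκ' : κ'.IsCyclotomic) (u : ℤ_[p]ˣ) (hu : u ∈ CommGroup.torsion ℤ_[p]ˣ) :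
    ∃ σ₀ : BigGaloisRep.LocalGroup K (Sum.inl vbar), σ₀ ∈ absInertia (vbar.adicCompletion K) ∧
      GaloisRep.cyclotomicCharacter K p (BigGaloisRep.localMap K (Sum.inl vbar) σ₀) = u ∧
      κ' (BigGaloisRep.localMap K (Sum.inl vbar) σ₀) = 1 ∧ κ (BigGaloisRep.localMap K (Sum.inl vbar) σ₀) = 1 := by
  obtain ⟨τ, hτI, hτχ, hκ'τ, hκτ⟩ := exists_mem_inertia_torsion_of_split hK2 hp2 hpv hpvbar hne
    (adicCompletionPrime_mem_primesAbove K vbar) κ κ' hκ' u hu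
  rw [inertia_adicCompletionPrime_eq_map_absInertia K vbar, Subgroup.mem_map] at hτI
  obtain ⟨σ₀, hσ₀, rfl⟩ := hτI
  exact ⟨σ₀, hσ₀, hτχ, hκ'τ, hκτ⟩

/-! ### The inertia inputs of the (FIX) assembly at the level of the local Galois group `Γ_{K_v̄}`
(`Summits/…/Theorems/ErratumRoadFiveFixedPartOfFrame.lean`, hypotheses `hprop` and `hram`). -/

/-- **Proportionality of two `ℤ_p`-characters on the local inertia group `I_{K_v̄} ≤ Γ_{K_v̄}`** at a split odd prime of a
quadratic field: `κ₁(σ)κ₂(τ) = κ₂(σ)κ₁(τ)` for `σ, τ ∈ absInertia (K_v̄)` (the tree's `toAdd_mul_comm_of_mem_inertia_of_ncard_primesOver_eq`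
on `I_{𝔓₀} = res(I_{K_v̄})`). [cite: SerreLocalFields1979, Ch. XIV §7 Thm. 2] [cite: Washington1997, §13.1] -/
theorem absInertia_toAdd_mul_comm_of_split (hK2 : Module.finrank ℚ K = 2) (hp2 : p ≠ 2)
    {v vbar : HeightOneSpectrum (𝓞 K)} (hpv : ((p : ℕ) : 𝓞 K) ∈ v.asIdeal)
    (hpvbar : ((p : ℕ) : 𝓞 K) ∈ vbar.asIdeal) (hne : vbar ≠ v) (κ₁ κ₂ : ZpExtension K p)
    {σ τ : BigGaloisRep.LocalGroup K (Sum.inl vbar)} (hσ : σ ∈ absInertia (vbar.adicCompletion K))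
    (hτ : τ ∈ absInertia (vbar.adicCompletion K)) :
    (κ₁ (BigGaloisRep.localMap K (Sum.inl vbar) σ)).toAdd * (κ₂ (BigGaloisRep.localMap K (Sum.inl vbar) τ)).toAdd =
      (κ₂ (BigGaloisRep.localMap K (Sum.inl vbar) σ)).toAdd * (κ₁ (BigGaloisRep.localMap K (Sum.inl vbar) τ)).toAdd := by
  have hp : p.Prime := Fact.out
  haveI : Algebra.IsQuadraticExtension ℚ K := ⟨hK2⟩
  haveI : IsGalois ℚ K := inferInstance
  obtain ⟨u₀, hwu, hu₀⟩ := exists_heightOneSpectrum_rat_under hp hpvbar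
  have hu₀eq : u₀ = vbar.under (𝓞 ℚ) :=
    HeightOneSpectrum.ext (by rw [← hwu, HeightOneSpectrum.under_asIdeal])
  have hsplit : (u₀.asIdeal.primesOver (𝓞 K)).ncard = Module.finrank ℚ K := by
    rw [hu₀eq]
    exact ncard_primesOver_under_eq_finrank_of_ne hK2 hpvbar hpv hne.symm
  have hI : ∀ {γ : BigGaloisRep.LocalGroup K (Sum.inl vbar)}, γ ∈ absInertia (vbar.adicCompletion K) →
      BigGaloisRep.localMap K (Sum.inl vbar) γ ∈ (adicCompletionPrime K vbar).inertia (absoluteGaloisGroup K) := by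
    intro γ hγ
    rw [inertia_adicCompletionPrime_eq_map_absInertia K vbar]
    exact Subgroup.mem_map_of_mem _ hγ
  have hdet := toAdd_mul_comm_of_mem_inertia_of_ncard_primesOver_eq hp2 hu₀ hsplit hwu
    (adicCompletionPrime_mem_primesAbove K vbar)
    κ₁.toContinuousMonoidHom.toMonoidHom κ₂.toContinuousMonoidHom.toMonoidHom
    κ₁.toContinuousMonoidHom.continuous κ₂.toContinuousMonoidHom.continuous (hI hσ) (hI hτ)
  exact hdet

/-- **The anticyclotomic character is ramified on the local inertia group `I_{K_v̄}`**: some `τ ∈ absInertia (K_v̄)` has `κ(res τ) ≠ 0`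
(the tree's `exists_mem_inertia_apply_ne_one_of_isAnticyclotomic` on `I_{𝔓₀} = res(I_{K_v̄})`). [cite: Brink2007, Cor. 1 (p. 2136)] -/
theorem exists_absInertia_apply_ne_one_of_isAnticyclotomic (hK : IsImaginaryQuadratic K) (hp2 : p ≠ 2)
    (κ : ZpExtension K p) (hκ : κ.IsAnticyclotomic)
    {vbar : HeightOneSpectrum (𝓞 K)} (hpvbar : ((p : ℕ) : 𝓞 K) ∈ vbar.asIdeal) :
    ∃ τ : BigGaloisRep.LocalGroup K (Sum.inl vbar), τ ∈ absInertia (vbar.adicCompletion K) ∧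
      κ (BigGaloisRep.localMap K (Sum.inl vbar) τ) ≠ 1 := by
  obtain ⟨τ', hτ'I, hτ'⟩ := exists_mem_inertia_apply_ne_one_of_isAnticyclotomic hK hp2 κ hκ hpvbar
    (adicCompletionPrime_mem_primesAbove K vbar)
  rw [inertia_adicCompletionPrime_eq_map_absInertia K vbar, Subgroup.mem_map] at hτ'I
  obtain ⟨τ, hτ, rfl⟩ := hτ'I
  exact ⟨τ, hτ, hτ'⟩

end Literature.NumberTheory.EllipticCurves.ZpExtension

end
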